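import Summits.QuantumFields.YangMills.Theorems.UnitScaleTiltProp7TransporterRowsOfSmallField
import Summits.QuantumFields.YangMills.Theorems.UnitScaleTiltProp7LocalAxialGaugeSmallField
import HarnessLib

/-!
# Route `UnitScaleTilt`, crux K1 «MinimiserStabilityRegPr» (stmt-QuantumFields-19200), EX row (5) `h3` (STOREY H), H-ROAD pipeline (i) → (ii) junction of ★CHAIR WORD №53 ∕ №56 (R4) ∕ RECORD 17df:
# **THE THREE TRANSPORTER ROWS OF print's Thm 3.1, WINDOWED TO A BALL, AND DISCHARGED IN THE LOCAL AXIAL GAUGE** — px19 g15's ✓`Prop7TransporterRowsOfSmallField` (`hRε hSε hSε'` from the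
# GLOBAL bond-matrix letters `∀ b, ‖V(b) − 1‖ ≤ ε₁`, `‖V(x,μ) − V(x−e_μ,μ)‖ ≤ ε₁′`) re-cut so that letters AND rows speak only of bonds whose source lies in a ball `tdist x₀ · ≤ R` (print's
# (3.35) is LOCAL; a global small-field gauge does not exist on few-block members — px13 g16 16:03:30Z ALERT, 17df), and then INHABITED at every member by the cover's axial gauge at the centre
# (✓∕⧗`Prop7LocalAxialGaugeSmallField` §3: `ε₁ = 48ε₀η`, `ε₁′ = 96ε₀η` on the `12ℓ+4` ball, from `RegPr` alone) — the windowed `hRε hSε hSε'` INPUT of H2 FILE 2 (pipeline (ii), px19 g16).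

Cell `ym3-torus` (HUMAN RULING D-0037; rung R3 = SU(2) YM₃ on T³ — NOT d = 4, NOT infinite volume, NOT a mass gap, NOT Clay).  Width seat `ym3-torus-px13` (gen 17);
`--supports stmt-QuantumFields-19200 --as helper`; count-neutral; THEOREMS ONLY (0 `def`, 0 `sorry`, default heartbeats).

WHAT IS PROVED (ns `Summit.QuantumFields.YangMills.Theorems.Prop7TransporterRowsOnBall`; member `F`, run `K`; then heights `n K`).
* §1 (any background `V`, any centre `x₀`, any radius `R`) ★ `hRε_on_ball`, ★ `hSε_on_ball` — `‖V(p) − 1‖ ≤ ε₁` for `tdist x₀ p₋ ≤ R` ⟹ `‖Ad(V(p))w − w‖, ‖Ad(V(p)⁻¹)w − w‖ ≤ (2√2·ε₁)‖w‖`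
  for the same bonds (✓`norm_adBg_sub_self_le`, ✓`norm_adBgInv_sub_self_le` pointwise); ★ `hSε'_on_ball` — the windowed two-bond letter `‖V(p) − V(p′)‖ ≤ ε₁′` (both sources on the ball) ⟹
  `‖Ad(V(x,μ)⁻¹)w − Ad(V(x−e_μ,μ)⁻¹)w‖ ≤ (2√2·ε₁′)‖w‖` whenever `x` and `x − e_μ` lie on the ball (✓`norm_adBgInv_sub_adBgInv_le`).
* §2 ★★★ `hRε_axialGauge_cover`, `hSε_axialGauge_cover`, `hSε'_axialGauge_cover` — AT EVERY MEMBER (no room): for `RegPr F n K ε₀ U₀` (`0 ≤ ε₀`) and every cover centre `ct`, the three rows for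
  `Ṽ := (U₀ ∘ π♭)^{σ̃_ct}`, `σ̃_ct = axialT (U₀ ∘ π♭) ct`, on the ball `tdist (ẽ ct) · ≤ 12ℓ+4` with `ε = 2√2·(48ε₀η)`, `ε′ = 2√2·(96ε₀η)` (§1 ∘ pipeline (i) §3).
HYP-SAT (★★OWNER RULING №42).  §1's letters are real inequalities inhabited at `V = 1` (`ε₁ = ε₁′ = 0`) and, K-free and ROOM-free, by §2 from `RegPr` (print's (8)); conclusions are lit's transporter
rows restricted to the ball; nothing conclusion-shaped is assumed.  HONEST SCOPE: fibre algebra over tree lemmas; H2 FILE 2 (the windowed random-walk ∕ resolvent Hölder row that CONSUMES these rows)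
is NOT proved here; nothing of `h3`, norm_G, EX, 19200 or the rung; the Yang–Mills mass gap is NOT proved.

References: T. Bałaban, CMP **99** (1985) 389–434 [Balaban1985BackgroundPropagators] ((3.8) p.392, (3.35) p.396, Thm 3.1 p.397); CMP **98** (1985) 17–51 [Balaban1985Averaging] ((18)–(20) p.21,
pp.24–25); CMP **102** (1985) 255–275 [Balaban1985RegularSpaces] (Thm 1 p.81, (1.36)–(1.37) p.82).
-/

set_option autoImplicit false

noncomputable section

open scoped InnerProductSpace ComplexConjugate BigOperators Matrix.Norms.L2Operator

namespace Summit.QuantumFields.YangMills.Theorems.Prop7TransporterRowsOnBall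

open Literature.MathematicalPhysics.QuantumFieldTheory.Balaban1983to89
open Literature.MathematicalPhysics.QuantumFieldTheory.Balaban1983to89.T3ContinuumYM3Torus
open B10Eq27TorusAxialLog (axialT)
open B4Sect5Torus (TSite tdist)
open B9SectCLatticeCarrier (Bond unshift)
open T3PrintedRegularMinimiser (RegPr)
open T3SectALandauChart (eta)
open Summit.QuantumFields.YangMills.Theorems.Prop7SectET3Transport (periodsT3 siteEquiv bgOfCfg)
open Summit.QuantumFields.YangMills.Theorems.Prop7SectET3HilbertLetters (W₂ adBg adBgInv)
open Summit.QuantumFields.YangMills.Theorems.Prop7TwoBackgroundGradientComparison (norm_adBg_sub_self_le norm_adBgInv_sub_self_le)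
open Summit.QuantumFields.YangMills.Theorems.Prop7TransporterRowsOfSmallField (norm_adBgInv_sub_adBgInv_le)
open Summit.QuantumFields.YangMills.Theorems.Prop7LocalAxialGaugeSmallField (norm_bgOfCfg_gaugeAct_axialT_sub_one_le_cover norm_bgOfCfg_sub_bgOfCfg_le_of_ball)
open Summit.QuantumFields.YangMills.Theorems.CoverSites
open Summit.QuantumFields.YangMills.Theorems.Prop7PoissonGradientDecayAllMembers (room_cover_three)
open Summit.QuantumFields.YangMills.Theorems.SmallMembersCoverLift (regPr_cover_iff)

variable (F : T3Family) (K : ℕ)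

/-! ## §1 The three rows windowed to a ball, any background -/

/-- ★ **`hRε` ON A BALL**: `‖V(p) − 1‖ ≤ ε₁` for the bonds with `tdist x₀ p₋ ≤ R` ⟹ `‖Ad(V(p))w − w‖ ≤ (2√2·ε₁)·‖w‖` for the same bonds.
[cite: Balaban1985BackgroundPropagators, (3.35) p.396; Balaban1985Averaging, (18)–(20) p.21] -/
theorem hRε_on_ball (V : GaugeField (F.P K) 0 (Matrix.specialUnitaryGroup (Fin 2) ℂ)) (x₀ : TSite 3 (periodsT3 F K)) (R : ℝ) {ε₁ : ℝ}
    (hV : ∀ p : Bond 3 (periodsT3 F K), tdist (periodsT3 F K) x₀ p.1 ≤ R → ‖((bgOfCfg F K V p : (Matrix (Fin 2) (Fin 2) ℂ)ˣ) : Matrix (Fin 2) (Fin 2) ℂ) - 1‖ ≤ ε₁) :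
    ∀ (p : Bond 3 (periodsT3 F K)) (w : W₂), tdist (periodsT3 F K) x₀ p.1 ≤ R → ‖adBg F K V p w - w‖ ≤ (2 * Real.sqrt 2 * ε₁) * ‖w‖ := by
  intro p w hp
  calc ‖adBg F K V p w - w‖ ≤ 2 * Real.sqrt 2 * ‖((bgOfCfg F K V p : (Matrix (Fin 2) (Fin 2) ℂ)ˣ) : Matrix (Fin 2) (Fin 2) ℂ) - 1‖ * ‖w‖ := norm_adBg_sub_self_le F K V p w
    _ ≤ (2 * Real.sqrt 2 * ε₁) * ‖w‖ := by
        have h0 : 0 ≤ 2 * Real.sqrt 2 := by positivity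
        exact mul_le_mul_of_nonneg_right (mul_le_mul_of_nonneg_left (hV p hp) h0) (norm_nonneg _)

/-- ★ **`hSε` ON A BALL**: `‖V(p) − 1‖ ≤ ε₁` for the bonds with `tdist x₀ p₋ ≤ R` ⟹ `‖Ad(V(p)⁻¹)w − w‖ ≤ (2√2·ε₁)·‖w‖` for the same bonds.
[cite: Balaban1985BackgroundPropagators, (3.35) p.396; Balaban1985Averaging, (18)–(20) p.21] -/
theorem hSε_on_ball (V : GaugeField (F.P K) 0 (Matrix.specialUnitaryGroup (Fin 2) ℂ)) (x₀ : TSite 3 (periodsT3 F K)) (R : ℝ) {ε₁ : ℝ}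
    (hV : ∀ p : Bond 3 (periodsT3 F K), tdist (periodsT3 F K) x₀ p.1 ≤ R → ‖((bgOfCfg F K V p : (Matrix (Fin 2) (Fin 2) ℂ)ˣ) : Matrix (Fin 2) (Fin 2) ℂ) - 1‖ ≤ ε₁) :
    ∀ (p : Bond 3 (periodsT3 F K)) (w : W₂), tdist (periodsT3 F K) x₀ p.1 ≤ R → ‖adBgInv F K V p w - w‖ ≤ (2 * Real.sqrt 2 * ε₁) * ‖w‖ := by
  intro p w hp
  calc ‖adBgInv F K V p w - w‖ ≤ 2 * Real.sqrt 2 * ‖((bgOfCfg F K V p : (Matrix (Fin 2) (Fin 2) ℂ)ˣ) : Matrix (Fin 2) (Fin 2) ℂ) - 1‖ * ‖w‖ := norm_adBgInv_sub_self_le F K V p w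
    _ ≤ (2 * Real.sqrt 2 * ε₁) * ‖w‖ := by
        have h0 : 0 ≤ 2 * Real.sqrt 2 := by positivity
        exact mul_le_mul_of_nonneg_right (mul_le_mul_of_nonneg_left (hV p hp) h0) (norm_nonneg _)

/-- ★ **`hSε'` ON A BALL**: the windowed two-bond letter `‖V(p) − V(p′)‖ ≤ ε₁′` (both sources on the ball) ⟹ `‖Ad(V(x,μ)⁻¹)w − Ad(V(x−e_μ,μ)⁻¹)w‖ ≤ (2√2·ε₁′)·‖w‖` whenever both `x` and `x − e_μ`
lie on the ball. [cite: Balaban1985BackgroundPropagators, (3.35) p.396; Balaban1985RegularSpaces, (1.36)–(1.37) p.82] -/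
theorem hSε'_on_ball (V : GaugeField (F.P K) 0 (Matrix.specialUnitaryGroup (Fin 2) ℂ)) (x₀ : TSite 3 (periodsT3 F K)) (R : ℝ) {ε₁' : ℝ}
    (hV' : ∀ p p' : Bond 3 (periodsT3 F K), tdist (periodsT3 F K) x₀ p.1 ≤ R → tdist (periodsT3 F K) x₀ p'.1 ≤ R →
      ‖((bgOfCfg F K V p : (Matrix (Fin 2) (Fin 2) ℂ)ˣ) : Matrix (Fin 2) (Fin 2) ℂ) - ((bgOfCfg F K V p' : (Matrix (Fin 2) (Fin 2) ℂ)ˣ) : Matrix (Fin 2) (Fin 2) ℂ)‖ ≤ ε₁') :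
    ∀ (x : TSite 3 (periodsT3 F K)) (μ : Fin 3) (w : W₂), tdist (periodsT3 F K) x₀ x ≤ R → tdist (periodsT3 F K) x₀ (unshift μ x) ≤ R →
      ‖adBgInv F K V (x, μ) w - adBgInv F K V (unshift μ x, μ) w‖ ≤ (2 * Real.sqrt 2 * ε₁') * ‖w‖ := by
  intro x μ w hx hx'
  calc ‖adBgInv F K V (x, μ) w - adBgInv F K V (unshift μ x, μ) w‖
      ≤ 2 * Real.sqrt 2 * ‖((bgOfCfg F K V (x, μ) : (Matrix (Fin 2) (Fin 2) ℂ)ˣ) : Matrix (Fin 2) (Fin 2) ℂ) - ((bgOfCfg F K V (unshift μ x, μ) : (Matrix (Fin 2) (Fin 2) ℂ)ˣ) : Matrix (Fin 2) (Fin 2) ℂ)‖ * ‖w‖ :=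
        norm_adBgInv_sub_adBgInv_le F K V (x, μ) (unshift μ x, μ) w
    _ ≤ (2 * Real.sqrt 2 * ε₁') * ‖w‖ := by
        have h0 : 0 ≤ 2 * Real.sqrt 2 := by positivity
        exact mul_le_mul_of_nonneg_right (mul_le_mul_of_nonneg_left (hV' (x, μ) (unshift μ x, μ) hx hx') h0) (norm_nonneg _)

/-! ## §2 ★★★ At every member: the rows in the cover's axial gauge at the centre, from `RegPr` alone -/

variable (n : ℕ)

/-- ★★★ **`hRε` IN THE LOCAL AXIAL GAUGE, EVERY MEMBER**: for `RegPr F n K ε₀ U₀` (`0 ≤ ε₀`) and every cover centre `ct`, the background `Ṽ := (U₀ ∘ π♭)^{σ̃_ct}` has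
`‖Ad(Ṽ(p̃))w − w‖ ≤ (2√2·(48ε₀η))·‖w‖` for every cover bond `p̃` with `tdist (ẽ ct) p̃₋ ≤ 12ℓ + 4` (§1 ∘ ✓∕⧗`norm_bgOfCfg_gaugeAct_axialT_sub_one_le_cover`).
[cite: Balaban1985BackgroundPropagators, (3.35) p.396; Balaban1985Averaging, pp.24-25] -/
theorem hRε_axialGauge_cover {ε₀ : ℝ} (hε₀ : 0 ≤ ε₀)
    (U₀ : GaugeField (F.P K) 0 (Matrix.specialUnitaryGroup (Fin 2) ℂ)) (hreg : RegPr F n K ε₀ U₀) (ct : Site ((F.cover 3).P K) 0) :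
    ∀ (p : Bond 3 (periodsT3 (F.cover 3) K)) (w : W₂), tdist (periodsT3 (F.cover 3) K) (siteEquiv (F.cover 3) K ct) p.1 ≤ 12 * (F.L : ℝ) ^ (K - n) + 4 →
      ‖adBg (F.cover 3) K (GaugeField.gaugeAct (axialT (U₀ ∘ projBond (F.P K) 3 0) ct) (U₀ ∘ projBond (F.P K) 3 0)) p w - w‖ ≤ (2 * Real.sqrt 2 * (48 * ε₀ * eta F n K)) * ‖w‖ :=
  hRε_on_ball (F.cover 3) K _ (siteEquiv (F.cover 3) K ct) (12 * (F.L : ℝ) ^ (K - n) + 4)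
    fun p hp => norm_bgOfCfg_gaugeAct_axialT_sub_one_le_cover F n K hε₀ U₀ hreg ct p.1 p.2 hp

/-- ★★★ **`hSε` IN THE LOCAL AXIAL GAUGE, EVERY MEMBER**: same hypotheses, `‖Ad(Ṽ(p̃)⁻¹)w − w‖ ≤ (2√2·(48ε₀η))·‖w‖` on the ball.
[cite: Balaban1985BackgroundPropagators, (3.35) p.396; Balaban1985Averaging, pp.24-25] -/
theorem hSε_axialGauge_cover {ε₀ : ℝ} (hε₀ : 0 ≤ ε₀)
    (U₀ : GaugeField (F.P K) 0 (Matrix.specialUnitaryGroup (Fin 2) ℂ)) (hreg : RegPr F n K ε₀ U₀) (ct : Site ((F.cover 3).P K) 0) :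
    ∀ (p : Bond 3 (periodsT3 (F.cover 3) K)) (w : W₂), tdist (periodsT3 (F.cover 3) K) (siteEquiv (F.cover 3) K ct) p.1 ≤ 12 * (F.L : ℝ) ^ (K - n) + 4 →
      ‖adBgInv (F.cover 3) K (GaugeField.gaugeAct (axialT (U₀ ∘ projBond (F.P K) 3 0) ct) (U₀ ∘ projBond (F.P K) 3 0)) p w - w‖ ≤ (2 * Real.sqrt 2 * (48 * ε₀ * eta F n K)) * ‖w‖ :=
  hSε_on_ball (F.cover 3) K _ (siteEquiv (F.cover 3) K ct) (12 * (F.L : ℝ) ^ (K - n) + 4)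
    fun p hp => norm_bgOfCfg_gaugeAct_axialT_sub_one_le_cover F n K hε₀ U₀ hreg ct p.1 p.2 hp

/-- ★★★ **`hSε'` IN THE LOCAL AXIAL GAUGE, EVERY MEMBER**: same hypotheses, `‖Ad(Ṽ(x̃,μ)⁻¹)w − Ad(Ṽ(x̃−e_μ,μ)⁻¹)w‖ ≤ (2√2·(2·(48ε₀η)))·‖w‖` whenever `x̃` and `x̃ − e_μ` lie on the ball
(§1 ∘ ✓∕⧗`norm_bgOfCfg_sub_bgOfCfg_le_of_ball` on the cover: room ✓`room_cover_three`, `PlaqSmall` ✓`regPr_cover_iff`).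
[cite: Balaban1985BackgroundPropagators, (3.35) p.396; Balaban1985RegularSpaces, (1.36)–(1.37) p.82] -/
theorem hSε'_axialGauge_cover {ε₀ : ℝ} (hε₀ : 0 ≤ ε₀)
    (U₀ : GaugeField (F.P K) 0 (Matrix.specialUnitaryGroup (Fin 2) ℂ)) (hreg : RegPr F n K ε₀ U₀) (ct : Site ((F.cover 3).P K) 0) :
    ∀ (x : TSite 3 (periodsT3 (F.cover 3) K)) (μ : Fin 3) (w : W₂),
      tdist (periodsT3 (F.cover 3) K) (siteEquiv (F.cover 3) K ct) x ≤ 12 * (F.L : ℝ) ^ (K - n) + 4 →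
      tdist (periodsT3 (F.cover 3) K) (siteEquiv (F.cover 3) K ct) (unshift μ x) ≤ 12 * (F.L : ℝ) ^ (K - n) + 4 →
      ‖adBgInv (F.cover 3) K (GaugeField.gaugeAct (axialT (U₀ ∘ projBond (F.P K) 3 0) ct) (U₀ ∘ projBond (F.P K) 3 0)) (x, μ) w
          - adBgInv (F.cover 3) K (GaugeField.gaugeAct (axialT (U₀ ∘ projBond (F.P K) 3 0) ct) (U₀ ∘ projBond (F.P K) 3 0)) (unshift μ x, μ) w‖
        ≤ (2 * Real.sqrt 2 * (2 * (48 * ε₀ * eta F n K))) * ‖w‖ :=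
  hSε'_on_ball (F.cover 3) K _ (siteEquiv (F.cover 3) K ct) (12 * (F.L : ℝ) ^ (K - n) + 4)
    fun p p' hp hp' => norm_bgOfCfg_sub_bgOfCfg_le_of_ball (F.cover 3) n K hε₀ (U₀ ∘ projBond (F.P K) 3 0) ((regPr_cover_iff 3 F ε₀ U₀).mpr hreg).1
      (room_cover_three F n K) ct p p' hp hp'

end Summit.QuantumFields.YangMills.Theorems.Prop7TransporterRowsOnBall

end
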